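import Literature.Topology.FourManifolds.KnotGroup
import Literature.Topology.FourManifolds.KnotGroupMulEquivProofs
import Literature.Topology.FourManifolds.DehnSurgeryUnknotZeroProofs
import Literature.Topology.FourManifolds.SphereTwoProdCircleSumFundamentalGroup
import HarnessLib

/-!
# The knot group of the unknot is `ℤ`: discharge of
`Literature.Topology.FourManifolds.nonempty_group_unknot_mulEquiv`

Sibling proof file of `KnotGroup.lean` (D-0014: the named fact
`def nonempty_group_unknot_mulEquiv : Prop` — "for every base point `x` of the complement of the
unknot `U ⊆ S³`, `π₁(S³ ∖ U, x) ≅ ℤ`", Rolfsen (1976) §3.A Example 1, Crowell–Fox (1963) Ch. VI §1 —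
is discharged here as `theorem nonempty_group_unknot_mulEquiv_holds`, sorry-free).

## The printed argument

Rolfsen, *Knots and Links*, §3.A Example 1: the complement of a great circle `U` in `S³` deformation
retracts onto the complementary great circle, so `π₁(S³ ∖ U) ≅ π₁(S¹) ≅ ℤ`; equivalently
(Rolfsen §9.G Example 3, "the exterior of the unknot is a solid torus") `S³ ∖ U` is an open solid
torus `D̊² × S¹`, whose fundamental group is `π₁(D̊²) × π₁(S¹) = 1 × ℤ` (Hatcher, Prop. 1.12,
Thm. 1.7).

## Its formalisation (everything reused from the tree)

* `Literature.Topology.FourManifolds.SurgeryUnknot.glueAHomeomorph` (`DehnSurgeryUnknotZeroProofs`):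
  the open solid-torus chart `jA : S³ ∖ U ⇀ S² × S¹`, `(y, v) ↦ ((2‖v‖y, ‖y‖² − ‖v‖²), v/‖v‖)`,
  an open partial homeomorphism with source `univ` and target `{q₂ < 1} × S¹`; hence
  `S³ ∖ U ≃ₜ {q ∈ S² | q₂ < 1} × S¹` (`nonempty_homeomorph_complement_unknot`).
* `{q ∈ S² | q₂ < 1} = S² ∖ {N}` is the source of Mathlib's stereographic projection
  `stereographic' 2 N` onto `ℝ²`, so it is simply connected (`ℝ²` is:
  `simplyConnectedSpace_of_normedSpace`, `SphereTwoProdCircleSumFundamentalGroup`), and its `π₁`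
  is trivial (Mathlib's `Subsingleton (FundamentalGroup X x)` for simply connected `X`).
* `π₁` of a product and transport along homeomorphisms (`fundamentalGroupProdEquiv`,
  `fundamentalGroupEquivOfHomeomorph`, `CircleAndTorus`), and `π₁` of the Euclidean unit circle
  `fundamentalGroupSphereOneEquiv : π₁(𝕊¹) ≃* Multiplicative ℤ`
  (`SphereTwoProdCircleSumFundamentalGroup`).

* Corollary (appended): **the unknot has trivial Alexander polynomial**, unconditionally
  (`unknot_hasTrivialAlexanderPolynomial`; Rolfsen §7.B Example 1) — the tree's conditional
  `hasTrivialAlexanderPolynomial_unknot` fed with this discharge, the discharge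
  `IsAlexanderPolynomial.of_mulEquiv_holds` (`KnotGroupMulEquivProofs`) and the explicit base point
  `SurgeryUnknot.complementBase` (so that no `[Knot.ComplementFacts]` instance is needed).

No new definitions, no named facts; the discharge holds for every instance of the `Prop`-valued
class `[SphereEmbedding.SmoothnessFacts]` under which `unknot` is defined.

## References

* D. Rolfsen, *Knots and Links*, Publish or Perish (1976), §3.A Example 1; §9.G Example 3.
  [cite: Rolfsen1976, §3.A Example 1]
* R. H. Crowell, R. H. Fox, *Introduction to Knot Theory* (1963), Ch. VI §1.
* A. Hatcher, *Algebraic Topology* (2002), Thm. 1.7, Prop. 1.12, Prop. 1.18. [cite: HatcherAT2002, Prop. 1.12]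
-/

open scoped Manifold ContDiff Topology
open Function Set Module

noncomputable section

namespace Literature.Topology.FourManifolds

open Literature.AlgebraicTopology.FundamentalGroup
open SurgeryUnknot

/-! ## The punctured `2`-sphere `{q₂ < 1} = S² ∖ {N}` is simply connected -/

/-- On the unit `2`-sphere, `q₂ < 1` unless `q` is the north pole `e₂ = (0, 0, 1)`:
`{q | q₂ < 1} = {e₂}ᶜ`. [folklore] -/
private theorem sphereTwo_heightLtOne_eq_compl_single :
    {q : Metric.sphere (0 : EuclideanSpace ℝ (Fin (2 + 1))) 1 |
        (q : EuclideanSpace ℝ (Fin (2 + 1))) 2 < 1} =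
      {⟨EuclideanSpace.single 2 1, by simp⟩}ᶜ := by
  ext q
  simp only [mem_setOf_eq, mem_compl_iff, mem_singleton_iff]
  constructor
  · rintro hlt rfl
    simp at hlt
  · intro hne
    by_contra hge
    rw [not_lt] at hge
    apply hne
    have hnorm : ‖(q : EuclideanSpace ℝ (Fin (2 + 1)))‖ = 1 := norm_eq_of_mem_sphere q
    have hsq : ∑ i, (q : EuclideanSpace ℝ (Fin (2 + 1))) i ^ 2 = 1 := by
      have h := EuclideanSpace.norm_sq_eq (q : EuclideanSpace ℝ (Fin (2 + 1)))
      have h' : ∑ i, ‖(q : EuclideanSpace ℝ (Fin (2 + 1))) i‖ ^ 2 =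
          ∑ i, (q : EuclideanSpace ℝ (Fin (2 + 1))) i ^ 2 :=
        Finset.sum_congr rfl fun i _ ↦ by rw [Real.norm_eq_abs, sq_abs]
      rw [← h', ← h, hnorm, one_pow]
    rw [Fin.sum_univ_three] at hsq
    have h2 : (q : EuclideanSpace ℝ (Fin (2 + 1))) 2 = 1 := by nlinarith
    have h0 : (q : EuclideanSpace ℝ (Fin (2 + 1))) 0 = 0 := by nlinarith
    have h1 : (q : EuclideanSpace ℝ (Fin (2 + 1))) 1 = 0 := by nlinarith
    apply Subtype.ext
    ext i
    fin_cases i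
    · simpa using h0
    · simpa using h1
    · simpa using h2

/-- **`S² ∖ {N}` is simply connected** (Hatcher (2002), proof of Prop. 1.14: "`Sⁿ − {x}` is
homeomorphic to `ℝⁿ`", which is simply connected): the punctured sphere `{q ∈ S² | q₂ < 1}` is the
source of the stereographic projection from the north pole onto `ℝ²` (Mathlib's `stereographic'`),
a homeomorphism, and `ℝ²` is simply connected (convex, `simplyConnectedSpace_of_normedSpace`).
[cite: HatcherAT2002, Prop. 1.14 (proof, p. 35)] -/
theorem simplyConnectedSpace_sphereTwo_heightLtOne :
    SimplyConnectedSpace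
      {q : Metric.sphere (0 : EuclideanSpace ℝ (Fin (2 + 1))) 1 |
        (q : EuclideanSpace ℝ (Fin (2 + 1))) 2 < 1} := by
  haveI : Fact (finrank ℝ (EuclideanSpace ℝ (Fin (2 + 1))) = 2 + 1) :=
    ⟨finrank_euclideanSpace_fin⟩
  set N : Metric.sphere (0 : EuclideanSpace ℝ (Fin (2 + 1))) 1 :=
    ⟨EuclideanSpace.single 2 1, by simp⟩ with hN
  let st := stereographic' 2 N
  have hsrc : st.source = ({N}ᶜ : Set _) := stereographic'_source N
  have htgt : st.target = univ := stereographic'_target N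
  -- `{q₂ < 1} ≃ₜ {N}ᶜ = st.source ≃ₜ st.target = univ ≃ₜ ℝ²`
  let e : {q : Metric.sphere (0 : EuclideanSpace ℝ (Fin (2 + 1))) 1 |
        (q : EuclideanSpace ℝ (Fin (2 + 1))) 2 < 1} ≃ₜ EuclideanSpace ℝ (Fin 2) :=
    (Homeomorph.setCongr (sphereTwo_heightLtOne_eq_compl_single.trans hsrc.symm)).trans
      (st.toHomeomorphSourceTarget.trans
        ((Homeomorph.setCongr htgt).trans (Homeomorph.Set.univ _)))
  haveI : SimplyConnectedSpace (EuclideanSpace ℝ (Fin 2)) := simplyConnectedSpace_of_normedSpace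
  exact e.toHomotopyEquiv.simplyConnectedSpace_iff.2 inferInstance

/-! ## The complement of the unknot is an open solid torus -/

variable [SphereEmbedding.SmoothnessFacts]

/-- **The exterior of the unknot is an open solid torus** (Rolfsen (1976), §9.G Example 3):
`S³ ∖ U ≃ₜ (S² ∖ {N}) × S¹`, from the tree's open solid-torus chart
`SurgeryUnknot.glueAHomeomorph` (source `univ`, target `{q₂ < 1} × S¹`).
[cite: Rolfsen1976, §9.G Example 3] -/
theorem nonempty_homeomorph_complement_unknot :
    Nonempty (unknot.complement ≃ₜ
      {q : Metric.sphere (0 : EuclideanSpace ℝ (Fin (2 + 1))) 1 |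
          (q : EuclideanSpace ℝ (Fin (2 + 1))) 2 < 1} ×
        Metric.sphere (0 : EuclideanSpace ℝ (Fin (1 + 1))) 1) := by
  have htgt : glueAHomeomorph.target =
      {q : Metric.sphere (0 : EuclideanSpace ℝ (Fin (2 + 1))) 1 |
          (q : EuclideanSpace ℝ (Fin (2 + 1))) 2 < 1} ×ˢ
        (univ : Set (Metric.sphere (0 : EuclideanSpace ℝ (Fin (1 + 1))) 1)) := by
    ext q
    simp [glueAHomeomorph, prod_univ]
  have hsrc : glueAHomeomorph.source = (univ : Set unknot.complement) := rfl
  exact ⟨((Homeomorph.Set.univ _).symm.trans (Homeomorph.setCongr hsrc.symm)).trans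
    (glueAHomeomorph.toHomeomorphSourceTarget.trans
      ((Homeomorph.setCongr htgt).trans
        ((Homeomorph.Set.prod _ _).trans
          ((Homeomorph.refl _).prodCongr (Homeomorph.Set.univ _)))))⟩

/-! ## The discharge -/

/-- **The knot group of the unknot is infinite cyclic**, `π₁(S³ ∖ U, x) ≅ ℤ` at every base point
(Rolfsen (1976), §3.A Example 1; Crowell–Fox (1963), Ch. VI §1): `S³ ∖ U ≃ₜ (S² ∖ {N}) × S¹`
(`nonempty_homeomorph_complement_unknot`), `π₁` is a homeomorphism invariant and multiplicative
(Hatcher Prop. 1.18, Prop. 1.12), `π₁(S² ∖ {N}) = 1` (`simplyConnectedSpace_sphereTwo_heightLtOne`)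
and `π₁(S¹) ≅ ℤ` (Hatcher Thm. 1.7, `fundamentalGroupSphereOneEquiv`). Discharges the named fact
`Literature.Topology.FourManifolds.nonempty_group_unknot_mulEquiv` of `KnotGroup.lean`.
[cite: Rolfsen1976, §3.A Example 1] [cite: HatcherAT2002, Prop. 1.12] -/
theorem nonempty_group_unknot_mulEquiv_holds : nonempty_group_unknot_mulEquiv := by
  intro x
  obtain ⟨e⟩ := nonempty_homeomorph_complement_unknot
  haveI := simplyConnectedSpace_sphereTwo_heightLtOne
  haveI : Unique (FundamentalGroup
      {q : Metric.sphere (0 : EuclideanSpace ℝ (Fin (2 + 1))) 1 |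
          (q : EuclideanSpace ℝ (Fin (2 + 1))) 2 < 1} (e x).1) :=
    uniqueOfSubsingleton 1
  exact ⟨((fundamentalGroupEquivOfHomeomorph e (rfl : e x = ((e x).1, (e x).2))).trans
    ((fundamentalGroupProdEquiv (e x).1 (e x).2).trans MulEquiv.uniqueProd)).trans
      (fundamentalGroupSphereOneEquiv (e x).2)⟩

/-! ## Corollary: the unknot has trivial Alexander polynomial -/

/-- **The unknot has trivial Alexander polynomial** `Δ_U ≐ 1`, unconditionally (Rolfsen (1976),
§7.B Example 1: the group of the unknot is `ℤ`, whose Alexander module vanishes): the tree's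
conditional theorem `hasTrivialAlexanderPolynomial_unknot` (`KnotGroup.lean`) with its two named-fact
hypotheses discharged — `π₁(S³ ∖ U) ≅ ℤ` (`nonempty_group_unknot_mulEquiv_holds`, this file) and the
invariance of Alexander polynomials under group isomorphisms
(`IsAlexanderPolynomial.of_mulEquiv_holds`, `KnotGroupMulEquivProofs.lean`) — at the explicit base
point `SurgeryUnknot.complementBase` of the complement, so that no `[Knot.ComplementFacts]` instance
is required. [cite: Rolfsen1976, §7.B Example 1] -/
theorem unknot_hasTrivialAlexanderPolynomial : unknot.HasTrivialAlexanderPolynomial := by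
  obtain ⟨e⟩ := nonempty_group_unknot_mulEquiv_holds complementBase
  exact ⟨complementBase,
    IsAlexanderPolynomial.of_mulEquiv_holds.{0} isAlexanderPolynomial_int_one e.symm⟩

end Literature.Topology.FourManifolds
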